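import Summits.HodgeConjecture.HodgeConjecture.Cruxes.BlochSeedDiscOne.ShellThreePairLaw

/-!
# The NINE-EIGHTHS IDENTITY over `Design` — kernel consumer of dual's alphabet-wide laws (anomaly g17, v1)

Seat: plan-lens-HodgeAV-anomaly g17 (planner, lens «anomaly», director-hodge req-36; claim-free evidence-only on
stmt-HodgeConjecture-18881).  Census row of record ◇₈ r3 j305149 (bc5-plan g8), unchanged.  READING-1 letter-model bookkeeping
toward ONE stub (`stub_rung_pad4_seedAt`) of ONE line (`Cruxes/BlochSeedDiscOne/Lines/birth.lean` 814a6a70c14e831a).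
HC ∕ HC_CM ∕ HC_AV ∕ H2 ∕ 18881 ∕ 30548 are NOT proved here or anywhere; `Nonex 14 199 8` is REFUTED as typed.

This file is the `Design`-level half of the nine-eighths law (bus RESULT-1 l.13986 (N1), memo
`NINE-EIGHTHS-anomaly-g17.md` v1.1 §2; the finite TABLE half is `NineEighthsTable.lean` v1.1 8f51f1bc67bb2fe1).
It uses ONLY dual g16's alphabet-wide, height-free, shell-free laws of `ShellThreePairLaw.lean` (tree v11+):
`mid_law_alphabet` (E = 2·(Σ_N − Σ_P) m·pm), `pair_law_alphabet` (E = 4·(Σ_N − Σ_P) m·pw), `degFive_law_alphabet`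
(4·(Σ_N − Σ_P) m·a2210∘σ = 2·(Σ_N − Σ_P) m·a2111∘σ' for all placements).  Hypotheses throughout: `D.OnAlphabet h`, `D.A1` — no ring,
no shell, no door, no height restriction.

* `phi16Z c` — the integer functional `16·Φ′(c)` of the certificate:
  `Σ_{(k,f,g) distinct, ordered} pm k f g  +  2·Σ_{(g,g') distinct, ordered} pw g g'  −  4·Σ_{12 placements} a2210∘σᵢ  +  6·Σ_k a2111∘τ_k`
  = `Σ₁₂ q r r + Σ₆ q q − Σ₁₂ q q r + 3·Σ₄ q r r r` in the class coordinates `q = 2|x||y|`, `r = colevel` (= `NineEighthsTable.phi16`).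
* `nine_eighths_identity` : `Σ_N m·phi16Z − Σ_P m·phi16Z = 18 · E h D`            (16 · 9∕8 = 18).
* `phi16Z_axis` : `phi16Z c = 0` for every AXIS cell (`x_f = 0 ∨ y_f = 0` at every slot).
* `nine_eighths_law_design` : if `Σ_P m·phi16Z ≤ 16·HP` (room table: Φ′ ≤ 1 on the alive H-bearing P shapes, Φ′ = 0 on hub-free = axis
  P cells, HP = H-bearing P mass) and `0 ≤ Σ_N m·phi16Z` (table: Φ′ ≥ 0 on the alive N shapes), then `9·(−E) ≤ 8·HP`.
  With S := −E ≥ 32 ((S3)) this is the floor `HP ≥ 36`, and with c ≥ 17 hub-free cells `Σ_P m ≥ 53 > 50` (`NineEighthsTable.pmass_floor_digits`).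
-/

set_option linter.dupNamespace false
set_option autoImplicit false

namespace Summit.HodgeConjecture.HodgeConjecture.Cruxes.BlochSeedDiscOne.NineEighthsIdentity

open Summit.HodgeConjecture.HodgeConjecture.Cruxes.BlochSeedDiscOne.DepthBoundA4
open Summit.HodgeConjecture.HodgeConjecture.Cruxes.BlochSeedDiscOne.RingTwoMassLaw
open Summit.HodgeConjecture.HodgeConjecture.Cruxes.BlochSeedDiscOne.RingTwoMassLaw.ClassLaw
open Summit.HodgeConjecture.HodgeConjecture.Cruxes.BlochSeedDiscOne.ShellThreePairLaw
open Summit.HodgeConjecture.HodgeConjecture.Cruxes.BlochSeedDiscOne.RingFourEmpty (linZ_add linZ_smul linZ_mono)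

/-! ## §1 Slot bookkeeping -/

/-- ordered triples of pairwise distinct slots (24). -/
def T3 : Finset (Fin 4 × Fin 4 × Fin 4) :=
  Finset.univ.filter fun t => t.1 ≠ t.2.1 ∧ t.1 ≠ t.2.2 ∧ t.2.1 ≠ t.2.2

/-- ordered pairs of distinct slots (12). -/
def T2 : Finset (Fin 4 × Fin 4) := Finset.univ.filter fun t => t.1 ≠ t.2

theorem card_T3 : T3.card = 24 := by decide
theorem card_T2 : T2.card = 12 := by decide

/-- the twelve placements `(σ0, σ1 ; σ2) = (a, b ; c)`, `a < b`, `c ∉ {a, b}`, of the shape `(2,2,1,0)`, as explicit permutations. -/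
def σA : Fin 12 → Equiv.Perm (Fin 4) :=
  ![1, Equiv.swap 2 3, Equiv.swap 1 2, Equiv.swap 1 2 * Equiv.swap 2 3, Equiv.swap 1 2 * Equiv.swap 1 3, Equiv.swap 1 3,
    Equiv.swap 0 1 * Equiv.swap 1 2, Equiv.swap 0 1 * Equiv.swap 1 2 * Equiv.swap 2 3,
    Equiv.swap 0 1 * Equiv.swap 1 2 * Equiv.swap 1 3, Equiv.swap 0 1 * Equiv.swap 1 3, Equiv.swap 0 2 * Equiv.swap 1 3,
    Equiv.swap 0 1 * Equiv.swap 0 2 * Equiv.swap 1 3]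

/-- sanity: the images `(σ0, σ1, σ2)` of the twelve placements are the twelve `(a, b; c)`. -/
theorem σA_images : (List.finRange 12).map (fun i => ((σA i) 0, (σA i) 1, (σA i) 2)) =
    [(0,1,2), (0,1,3), (0,2,1), (0,2,3), (0,3,1), (0,3,2), (1,2,0), (1,2,3), (1,3,0), (1,3,2), (2,3,0), (2,3,1)] := by decide

/-- the four placements `σ0 = k` of the shape `(2,1,1,1)`. -/
def τA (k : Fin 4) : Equiv.Perm (Fin 4) := Equiv.swap 0 k

theorem τA_zero (k : Fin 4) : τA k 0 = k := by simp [τA]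

/-! ## §2 The functional `16·Φ′` and the identity -/

/-- `16·Φ′` as an integer functional on cells. -/
def phi16Z (c : Cell) : ℤ :=
  (∑ t ∈ T3, pm t.1 t.2.1 t.2.2 c) + 2 * (∑ t ∈ T2, pw t.1 t.2 c)
    + (-4) * (∑ i : Fin 12, a2210 (σA i) c) + 6 * (∑ k : Fin 4, a2111 (τA k) c)

theorem linZ_fsum {ι : Type*} (L : List (Cell × ℕ)) (s : Finset ι) (φ : ι → Cell → ℤ) :
    linZ L (fun c => ∑ i ∈ s, φ i c) = ∑ i ∈ s, linZ L (φ i) := by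
  induction L with
  | nil => simp [linZ_nil]
  | cons a t ih =>
    simp only [linZ_cons]
    rw [ih, Finset.mul_sum, ← Finset.sum_add_distrib]

/-- expansion of `Σ m·phi16Z` over one side. -/
theorem linZ_phi16Z (L : List (Cell × ℕ)) : linZ L phi16Z =
    (∑ t ∈ T3, linZ L (pm t.1 t.2.1 t.2.2)) + 2 * (∑ t ∈ T2, linZ L (pw t.1 t.2))
      + (-4) * (∑ i : Fin 12, linZ L (a2210 (σA i))) + 6 * (∑ k : Fin 4, linZ L (a2111 (τA k))) := by
  have e : phi16Z = fun c => ((fun c => ∑ t ∈ T3, pm t.1 t.2.1 t.2.2 c) c + (fun c => 2 * (∑ t ∈ T2, pw t.1 t.2 c)) c)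
      + ((fun c => (-4) * (∑ i : Fin 12, a2210 (σA i) c)) c + (fun c => 6 * (∑ k : Fin 4, a2111 (τA k) c)) c) := by
    funext c; simp only [phi16Z]; ring
  rw [e, linZ_add, linZ_add, linZ_add, linZ_smul, linZ_smul, linZ_smul, linZ_fsum, linZ_fsum, linZ_fsum, linZ_fsum]
  ring

/-- **THE NINE-EIGHTHS IDENTITY** (clause 2 of (A1) on the alphabet; every height, every shell):
`Σ_N m·(16Φ′) − Σ_P m·(16Φ′) = 18·E`. -/
theorem nine_eighths_identity {h : ℤ} {D : Design} (hD : D.OnAlphabet h) (h1 : D.A1) :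
    linZ D.N phi16Z - linZ D.P phi16Z = 18 * E h D := by
  -- the 24 mixed laws
  have hT3 : ∑ t ∈ T3, (2 * linZ D.N (pm t.1 t.2.1 t.2.2) - 2 * linZ D.P (pm t.1 t.2.1 t.2.2)) = 24 * E h D := by
    rw [Finset.sum_congr rfl (g := fun _ => E h D) fun t ht => ?_, Finset.sum_const, card_T3, nsmul_eq_mul]
    · norm_num
    · obtain ⟨hkf, hkg, hfg⟩ := (Finset.mem_filter.mp ht).2
      have := mid_law_alphabet hD h1 hkf hkg hfg
      linarith
  -- the 12 pair laws
  have hT2 : ∑ t ∈ T2, (4 * linZ D.N (pw t.1 t.2) - 4 * linZ D.P (pw t.1 t.2)) = 12 * E h D := by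
    rw [Finset.sum_congr rfl (g := fun _ => E h D) fun t ht => ?_, Finset.sum_const, card_T2, nsmul_eq_mul]
    · norm_num
    · have hne := (Finset.mem_filter.mp ht).2
      have := pair_law_alphabet hD h1 hne
      linarith
  -- the degree-5 laws: every placement of (2,2,1,0) and of (2,1,1,1) has the same signed moment Φ₅' := 2·(Σ_N − Σ_P) m·a2111∘τ₀
  have hA : ∑ i : Fin 12, (4 * linZ D.N (a2210 (σA i)) - 4 * linZ D.P (a2210 (σA i)))
      = 12 * (2 * (linZ D.N (a2111 (τA 0)) - linZ D.P (a2111 (τA 0)))) := by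
    rw [Finset.sum_congr rfl (g := fun _ => 2 * (linZ D.N (a2111 (τA 0)) - linZ D.P (a2111 (τA 0)))) fun i _ => ?_,
      Finset.sum_const, Finset.card_univ, Fintype.card_fin, nsmul_eq_mul]
    · norm_num
    · have := degFive_law_alphabet hD h1 (σA i) (τA 0)
      linarith
  have hB : ∑ k : Fin 4, (2 * linZ D.N (a2111 (τA k)) - 2 * linZ D.P (a2111 (τA k)))
      = 4 * (2 * (linZ D.N (a2111 (τA 0)) - linZ D.P (a2111 (τA 0)))) := by
    rw [Finset.sum_congr rfl (g := fun _ => 2 * (linZ D.N (a2111 (τA 0)) - linZ D.P (a2111 (τA 0)))) fun k _ => ?_,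
      Finset.sum_const, Finset.card_univ, Fintype.card_fin, nsmul_eq_mul]
    · norm_num
    · have a := degFive_law_alphabet hD h1 (σA 0) (τA k)
      have b := degFive_law_alphabet hD h1 (σA 0) (τA 0)
      linarith
  simp only [Finset.sum_sub_distrib, ← Finset.mul_sum] at hT3 hT2 hA hB
  rw [linZ_phi16Z, linZ_phi16Z]
  linarith

/-- the same identity read as «P-moment = N-moment + 18·S» with `S := −E`. -/
theorem pmoment_eq {h : ℤ} {D : Design} (hD : D.OnAlphabet h) (h1 : D.A1) :
    linZ D.P phi16Z = linZ D.N phi16Z + 18 * (-(E h D)) := by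
  have := nine_eighths_identity hD h1
  linarith

/-! ## §3 Pointwise facts that need no table -/

theorem absxy_eq_zero_of_axis {ℓ : Letter} (hℓ : ℓ.x = 0 ∨ ℓ.y = 0) : |ℓ.x| * |ℓ.y| = 0 := by
  rcases hℓ with h0 | h0 <;> simp [h0]

/-- `16Φ′` vanishes on every AXIS cell (each of the four shape functionals carries a factor `|x_f|·|y_f|`). -/
theorem phi16Z_axis {c : Cell} (hc : ∀ f : Fin 4, (c f).x = 0 ∨ (c f).y = 0) : phi16Z c = 0 := by
  have hz : ∀ f : Fin 4, |(c f).x| * |(c f).y| = 0 := fun f => absxy_eq_zero_of_axis (hc f)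
  have h1 : ∀ t ∈ T3, pm t.1 t.2.1 t.2.2 c = 0 := fun t _ => by unfold pm; rw [hz]; ring
  have h2 : ∀ t ∈ T2, pw t.1 t.2 c = 0 := fun t _ => by unfold pw; rw [hz]; ring
  have h3 : ∀ i ∈ (Finset.univ : Finset (Fin 12)), a2210 (σA i) c = 0 := fun i _ => by unfold a2210; rw [hz]; ring
  have h4 : ∀ k ∈ (Finset.univ : Finset (Fin 4)), a2111 (τA k) c = 0 := fun k _ => by unfold a2111; rw [hz]; ring
  unfold phi16Z
  rw [Finset.sum_eq_zero h1, Finset.sum_eq_zero h2, Finset.sum_eq_zero h3, Finset.sum_eq_zero h4]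
  ring

theorem pm_nonneg' (k f g : Fin 4) (c : Cell) (hf : 0 ≤ (c f).colevel) (hg : 0 ≤ (c g).colevel) : 0 ≤ pm k f g c := by
  unfold pm; positivity

/-! ## §4 The law: identity + room table ⇒ `9·S ≤ 8·HP` -/

/-- **NINE-EIGHTHS LAW over `Design`.**  `HP` is any integer with `Σ_P m·(16Φ′) ≤ 16·HP` — in the application HP = the H-bearing
P mass, the bound coming from a ROOM TABLE «16Φ′ ≤ 16 on every alive H-bearing P shape» (`NineEighthsTable.phi16_le_sixteen_of_hb`
at shell 3) together with `phi16Z_axis` on the hub-free (= axis, binder (M2)) P cells; and `0 ≤ Σ_N m·(16Φ′)` from «16Φ′ ≥ 0 on every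
alive N shape» (`NineEighthsTable.phi16_nonneg` at shell 3; at shell s ≥ 4 the N shapes with 16Φ′ < 0 must be door-dead).
Conclusion: `9·S ≤ 8·HP` with `S = −E`. -/
theorem nine_eighths_law_design {h : ℤ} {D : Design} (hD : D.OnAlphabet h) (h1 : D.A1) (HP : ℤ)
    (hP : linZ D.P phi16Z ≤ 16 * HP) (hN : 0 ≤ linZ D.N phi16Z) : 9 * (-(E h D)) ≤ 8 * HP := by
  have := pmoment_eq hD h1
  linarith

/-- mass form of the pointwise hypotheses: if `16Φ′ ≤ 16·χ` pointwise on the counted P cells for an indicator-like `χ`, then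
`Σ_P m·16Φ′ ≤ 16·Σ_P m·χ`; if `0 ≤ 16Φ′` pointwise on the counted N cells then `0 ≤ Σ_N m·16Φ′`. -/
theorem pmoment_le_of_pointwise (D : Design) (χ : Cell → ℤ) (hP : ∀ cm ∈ D.P, 0 < cm.2 → phi16Z cm.1 ≤ 16 * χ cm.1) :
    linZ D.P phi16Z ≤ 16 * linZ D.P χ := by
  rw [← linZ_smul]
  exact linZ_mono D.P phi16Z (fun c => 16 * χ c) hP

theorem nmoment_nonneg_of_pointwise (D : Design) (hN : ∀ cm ∈ D.N, 0 < cm.2 → 0 ≤ phi16Z cm.1) : 0 ≤ linZ D.N phi16Z :=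
  linZ_nonneg D.N phi16Z hN

/-- **THE FLOOR.**  Under the two table facts (as mass inequalities), `S ≥ 32` ((S3) BALANCE LAW) and `c ≥ 17` hub-free P cells
((S2)), with `Σ_P m = HP + c`:  `Σ_P m ≥ 53 > 50`. -/
theorem pmass_floor {h : ℤ} {D : Design} (hD : D.OnAlphabet h) (h1 : D.A1) (HP c : ℤ)
    (hP : linZ D.P phi16Z ≤ 16 * HP) (hN : 0 ≤ linZ D.N phi16Z) (hS : 32 ≤ -(E h D)) (hc : 17 ≤ c) : 53 ≤ HP + c := by
  have := nine_eighths_law_design hD h1 HP hP hN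
  omega

/-! ## §5 Sanity: `phi16Z` against the class table (`NineEighthsTable.table_digits`, `shell4_digits`) -/

section Sanity
set_option maxRecDepth 1000000
/-- P `AADH` (A = (12; 2, 0), A′ = (12; 0, −2), D = (11; 2, 1), H = (14; 0, 0)): 16Φ′ = 16. -/
example : phi16Z ![⟨12, 2, 0⟩, ⟨12, 0, -2⟩, ⟨11, 2, 1⟩, ⟨14, 0, 0⟩] = 16 := by decide
/-- `DDHH`: 16. -/
example : phi16Z ![⟨11, -2, 1⟩, ⟨14, 0, 0⟩, ⟨11, 1, -2⟩, ⟨14, 0, 0⟩] = 16 := by decide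
/-- `BDHu`: 14. -/
example : phi16Z ![⟨12, 1, 1⟩, ⟨11, 2, -1⟩, ⟨14, 0, 0⟩, ⟨13, 0, 1⟩] = 14 := by decide
/-- `u⁴` (axis): 0. -/
example : phi16Z ![⟨13, 1, 0⟩, ⟨13, 0, 1⟩, ⟨13, -1, 0⟩, ⟨13, 0, -1⟩] = 0 := by decide
/-- shell 4: P `GGHH` (G = (10; 2, 2)): 64; N-type `GGGH`: −192; `EEGH` (E = (10; 4, 0)): 128. -/
example : phi16Z ![⟨10, 2, 2⟩, ⟨10, -2, 2⟩, ⟨14, 0, 0⟩, ⟨14, 0, 0⟩] = 64 := by decide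
example : phi16Z ![⟨10, 2, 2⟩, ⟨10, -2, 2⟩, ⟨10, 2, -2⟩, ⟨14, 0, 0⟩] = -192 := by decide
example : phi16Z ![⟨10, 4, 0⟩, ⟨10, 0, 4⟩, ⟨10, 2, -2⟩, ⟨14, 0, 0⟩] = 128 := by decide
end Sanity

end Summit.HodgeConjecture.HodgeConjecture.Cruxes.BlochSeedDiscOne.NineEighthsIdentity
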